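import Summits.MatrixMultiplication.OmegaCensus.STPPSmallPatternT1K6OrderLawSeeds
import Summits.MatrixMultiplication.OmegaCensus.STPPSmallPatternT1K6OrderLawCore
import Summits.MatrixMultiplication.OmegaCensus.STPPSmallPatternCyclicRaysT1

/-!
# ω-census, small STPP pattern `(2,1,1)^k`: THE LAW «EVERY FINITE ABELIAN GROUP OF ORDER ≥ 30 HOSTS (2,1,1)⁶» (kernel)

Cell `pub-omega`, ω construction census, seat pub-omega ENG2 (gen 33). HONEST FRAMING (verbatim): lottery ticket; floor =
certified bounds/negative ranges.  Census STRUCTURE bookkeeping (column B5, `T1`, «above the onset, ORDER — not type — decides», here for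
`k = 6`; same construction as `STPPSmallPatternT1K4OrderLaw.lean` / stpp-3's `STPPSmallPatternT2K4OrderLaw.lean`); nothing here bears on `ω`.

* `exists_isSTPP_211pow6_of_card_ge_30` — **every finite abelian group of order `≥ 30` admits an STPP family of size pattern `(2,1,1)⁶`.**

Proof: exponent `≥ 30` ⇒ an element of order `≥ 30` ⇒ ENG2 gen 32's cyclic ray `exists_isSTPP_211pow6_of_addOrderOf`; exponent `E ≤ 29` ⇒
structure theorem, every prime-power factor divides `E`, the factor multiset capped by `capMS (capList E)` keeps product `≥ 30` (`prod_inter_ge30_6`),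
and the kernel core `hostCore211K6_of_capped` shows it dominates one of the 38 MINIMAL seed types (`STPPSmallPatternT1K6OrderLawSeeds.lean`,
each with a decide witness); `exists_emb_of_dom` embeds the seed group and the witness is transported.

References: H. Cohn, R. Kleinberg, B. Szegedy, C. Umans, FOCS 2005 (arXiv:math/0511460), Def. 5.1.  Seat pub-omega ENG2 (gen 33), 2026-08-28.
-/

open Literature.Computability.AlgebraicComplexity Finset

namespace Summit.MatrixMultiplication.OmegaCensus

/-! ## 1. The 38 minimal host seeds -/

/-- Every listed seed type hosts `(2,1,1)⁶` (kernel witnesses of `STPPSmallPatternT1K6OrderLawSeeds.lean`; `SeedType s` unfolds to the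
witness's product type). [cite: CohnKleinbergSzegedyUmans2005, Def. 5.1] -/
theorem exists_211pow6_of_mem_hostSeeds211K6 : ∀ s ∈ ([[2, 2, 2, 2, 2], [4, 2, 2, 2], [8, 2, 2], [4, 4, 2], [16, 2], [8, 4], [3, 3, 2, 2], [9, 2, 2], [4, 3, 3], [5, 2, 2, 2], [5, 4, 2], [11, 2, 2], [5, 3, 3], [3, 2, 2, 2, 2], [4, 3, 2, 2], [8, 3, 2], [4, 4, 3], [7, 7], [5, 5, 2], [13, 2, 2], [3, 3, 3, 2], [9, 3, 2], [7, 2, 2, 2], [7, 4, 2], [7, 3, 3], [5, 5, 3], [3, 3, 3, 3], [9, 3, 3], [27, 3], [9, 9], [11, 11], [5, 5, 5], [25, 5], [13, 13], [17, 17], [19, 19], [23, 23], [29, 29]] : List (List ℕ)),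
    ∃ A B C : Fin 6 → Finset (SeedType s), IsSTPP A B C ∧ ∀ i, (A i).card = 2 ∧ (B i).card = 1 ∧ (C i).card = 1 := by
  intro s hs
  simp only [List.mem_cons, List.mem_nil_iff, or_false] at hs
  rcases hs with rfl | rfl | rfl | rfl | rfl | rfl | rfl | rfl | rfl | rfl | rfl | rfl | rfl | rfl | rfl | rfl | rfl | rfl | rfl | rfl | rfl | rfl | rfl | rfl | rfl | rfl | rfl | rfl | rfl | rfl | rfl | rfl | rfl | rfl | rfl | rfl | rfl | rfl
  · exact exists_isSTPP_211pow6_pp_2_2_2_2_2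
  · exact exists_isSTPP_211pow6_seed_4_2_2_2
  · exact exists_isSTPP_211pow6_seed_8_2_2
  · exact exists_isSTPP_211pow6_seed_4_4_2
  · exact exists_isSTPP_211pow6_seed_16_2
  · exact exists_isSTPP_211pow6_seed_8_4
  · exact exists_isSTPP_211pow6_seed_3_3_2_2
  · exact exists_isSTPP_211pow6_seed_9_2_2
  · exact exists_isSTPP_211pow6_seed_4_3_3
  · exact exists_isSTPP_211pow6_seed_5_2_2_2
  · exact exists_isSTPP_211pow6_seed_5_4_2
  · exact exists_isSTPP_211pow6_seed_11_2_2
  · exact exists_isSTPP_211pow6_seed_5_3_3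
  · exact exists_isSTPP_211pow6_seed_3_2_2_2_2
  · exact exists_isSTPP_211pow6_seed_4_3_2_2
  · exact exists_isSTPP_211pow6_seed_8_3_2
  · exact exists_isSTPP_211pow6_seed_4_4_3
  · exact exists_isSTPP_211pow6_seed_7_7
  · exact exists_isSTPP_211pow6_seed_5_5_2
  · exact exists_isSTPP_211pow6_seed_13_2_2
  · exact exists_isSTPP_211pow6_seed_3_3_3_2
  · exact exists_isSTPP_211pow6_seed_9_3_2
  · exact exists_isSTPP_211pow6_seed_7_2_2_2
  · exact exists_isSTPP_211pow6_seed_7_4_2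
  · exact exists_isSTPP_211pow6_seed_7_3_3
  · exact exists_isSTPP_211pow6_seed_5_5_3
  · exact exists_isSTPP_211pow6_seed_3_3_3_3
  · exact exists_isSTPP_211pow6_seed_9_3_3
  · exact exists_isSTPP_211pow6_seed_27_3
  · exact exists_isSTPP_211pow6_seed_9_9
  · exact exists_isSTPP_211pow6_seed_11_11
  · exact exists_isSTPP_211pow6_seed_5_5_5
  · exact exists_isSTPP_211pow6_seed_25_5
  · exact exists_isSTPP_211pow6_seed_13_13
  · exact exists_isSTPP_211pow6_seed_17_17
  · exact exists_isSTPP_211pow6_seed_19_19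
  · exact exists_isSTPP_211pow6_seed_23_23
  · exact exists_isSTPP_211pow6_seed_29_29

/-! ## 2. The capping step at threshold 30 -/

/-- If every element `a` of `M` satisfies `30 ≤ a ^ count a C` and `1 ≤ a`, and `30 ≤ M.prod`, then `M ∩ C` still has product `≥ 30`
(`prod_inter_ge` of `STPP222CubeFrom46.lean` at threshold `30`). -/
theorem prod_inter_ge30_6 {M C : Multiset ℕ} (hM : 30 ≤ M.prod) (hpos : ∀ a ∈ M, 1 ≤ a)
    (hcap : ∀ a ∈ M, 30 ≤ a ^ Multiset.count a C) : 30 ≤ (M ∩ C).prod := by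
  by_cases hle : M ≤ C
  · have : M ∩ C = M := le_antisymm Multiset.inter_le_left (Multiset.le_inter le_rfl hle)
    rw [this]; exact hM
  · rw [Multiset.le_iff_count] at hle
    push Not at hle
    obtain ⟨a, ha⟩ := hle
    have haM : a ∈ M := Multiset.count_pos.1 (by omega)
    have hcnt : Multiset.count a (M ∩ C) = Multiset.count a C := by
      rw [Multiset.count_inter]; omega
    have hrep : Multiset.replicate (Multiset.count a C) a ≤ M ∩ C :=
      Multiset.le_count_iff_replicate_le.1 hcnt.ge
    obtain ⟨R, hR⟩ := Multiset.le_iff_exists_add.1 hrep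
    have hRpos : ∀ x ∈ R, 1 ≤ x := fun x hx =>
      hpos x (Multiset.mem_of_le Multiset.inter_le_left (hR ▸ Multiset.mem_add.2 (Or.inr hx)))
    have h1 : 1 ≤ R.prod := Multiset.one_le_prod_of_one_le hRpos
    rw [hR, Multiset.prod_add, Multiset.prod_replicate]
    calc 30 ≤ a ^ Multiset.count a C := hcap a haM
      _ = a ^ Multiset.count a C * 1 := (mul_one _).symm
      _ ≤ a ^ Multiset.count a C * R.prod := Nat.mul_le_mul_left _ h1

/-- Domination for an arbitrary multiset of prime powers from `ppList`, all dividing some `1 ≤ E ≤ 29`, with product `≥ 30`. -/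
theorem exists_hostSeed211K6_dom {M : Multiset ℕ} {E : ℕ} (hE1 : 1 ≤ E) (hEmax : E ≤ 29)
    (hpp : ∀ a ∈ M, a ∈ ppList) (hdvd : ∀ a ∈ M, a ∣ E) (hprod : 30 ≤ M.prod) :
    ∃ s ∈ ([[2, 2, 2, 2, 2], [4, 2, 2, 2], [8, 2, 2], [4, 4, 2], [16, 2], [8, 4], [3, 3, 2, 2], [9, 2, 2], [4, 3, 3], [5, 2, 2, 2], [5, 4, 2], [11, 2, 2], [5, 3, 3], [3, 2, 2, 2, 2], [4, 3, 2, 2], [8, 3, 2], [4, 4, 3], [7, 7], [5, 5, 2], [13, 2, 2], [3, 3, 3, 2], [9, 3, 2], [7, 2, 2, 2], [7, 4, 2], [7, 3, 3], [5, 5, 3], [3, 3, 3, 3], [9, 3, 3], [27, 3], [9, 9], [11, 11], [5, 5, 5], [25, 5], [13, 13], [17, 17], [19, 19], [23, 23], [29, 29]] : List (List ℕ)), dom s M = true := by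
  have hEI : E ∈ List.range' 1 29 := List.mem_range'_1.2 ⟨hE1, by omega⟩
  have hEI45 : E ∈ List.range' 1 45 := List.mem_range'_1.2 ⟨hE1, by omega⟩
  set C := capMS (capList E) with hC
  have hcapd := prod_inter_ge30_6 (C := C) hprod (fun a ha => one_le_of_mem_ppList (hpp a ha))
    (fun a ha => le_trans (by norm_num) (cap_spec E hEI45 a (hpp a ha) (hdvd a ha)))
  have hmem : M ∩ C ∈ subMS (capList E) := mem_subMS_of_le _ _ Multiset.inter_le_right
  obtain ⟨s, hs, hD⟩ := hostCore211K6_of_capped E hEI (M ∩ C) hmem hcapd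
  exact ⟨s, hs, dom_mono s Multiset.inter_le_left hD⟩

/-! ## 3. The law -/

/-- The product form: `Π i, ℤ/pᵢ^eᵢ` admits `(2,1,1)⁶` as soon as every `pᵢ^eᵢ` divides some `1 ≤ E ≤ 29` and `∏ pᵢ^eᵢ ≥ 30`.
[cite: CohnKleinbergSzegedyUmans2005, Def. 5.1] -/
theorem exists_isSTPP_211pow6_pi {ι : Type} [Fintype ι] [DecidableEq ι] (p e : ι → ℕ)
    (hp : ∀ i, (p i).Prime) {E : ℕ} (hE1 : 1 ≤ E) (hEmax : E ≤ 29) (hdvd : ∀ i, p i ^ e i ∣ E)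
    (hcard : 30 ≤ ∏ i, p i ^ e i) :
    ∃ A B C : Fin 6 → Finset (Π i, ZMod (p i ^ e i)), IsSTPP A B C ∧
      ∀ i, (A i).card = 2 ∧ (B i).card = 1 ∧ (C i).card = 1 := by
  have hq0 : ∀ i, p i ^ e i ≠ 0 := fun i => pow_ne_zero _ (hp i).ne_zero
  have hprod : 30 ≤ ((Finset.univ.filter fun i => 0 < e i).val.map fun i => p i ^ e i).prod := by
    have : ((Finset.univ.filter fun i => 0 < e i).val.map fun i => p i ^ e i).prod = ∏ i, p i ^ e i := by
      rw [← Finset.prod_eq_multiset_prod]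
      exact Finset.prod_filter_of_ne fun i _ hi => Nat.pos_of_ne_zero fun h0 => hi (by rw [h0, pow_zero])
    rw [this]; exact hcard
  have hmem : ∀ a ∈ ((Finset.univ.filter fun i => 0 < e i).val.map fun i => p i ^ e i),
      a ∈ ppList ∧ a ∣ E := by
    intro a ha
    obtain ⟨i, hi, rfl⟩ := Multiset.mem_map.1 ha
    have hi' : 0 < e i := (Finset.mem_filter.1 hi).2
    exact ⟨pow_mem_ppList (hp i) hi' (le_trans (Nat.le_of_dvd (by omega) (hdvd i)) (by omega)), hdvd i⟩
  obtain ⟨s, hs, hD⟩ :=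
    exists_hostSeed211K6_dom hE1 hEmax (fun a ha => (hmem a ha).1) (fun a ha => (hmem a ha).2) hprod
  obtain ⟨φ, hφ, -⟩ := exists_emb_of_dom (fun i => p i ^ e i) hq0 s _ hD
  exact exists_isSTPP_211_of_injective φ hφ (exists_211pow6_of_mem_hostSeeds211K6 s hs)

/-- **THE LAW: every finite abelian group of order `≥ 30` admits an STPP family of size pattern `(2,1,1)⁶`** (CKSU Def. 5.1, tree `IsSTPP`).
Exponent `≥ 30`: the cyclic ray; exponent `≤ 29`: structure theorem + kernel-decided domination of one of 38 minimal seed types + generic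
embedding.  No `ω` bound follows. [cite: CohnKleinbergSzegedyUmans2005, Def. 5.1] -/
theorem exists_isSTPP_211pow6_of_card_ge_30 {G : Type*} [AddCommGroup G] [Finite G] (hG : 30 ≤ Nat.card G) :
    ∃ A B C : Fin 6 → Finset G, IsSTPP A B C ∧ ∀ i, (A i).card = 2 ∧ (B i).card = 1 ∧ (C i).card = 1 := by
  classical
  by_cases hexp : 30 ≤ AddMonoid.exponent G
  · obtain ⟨g, hg⟩ := AddMonoid.exists_addOrderOf_eq_exponent (AddMonoid.ExponentExists.of_finite (G := G))
    exact exists_isSTPP_211pow6_of_addOrderOf g (by rw [hg]; exact hexp)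
  obtain ⟨ι, _, p, hp, e, ⟨g⟩⟩ := AddCommGroup.equiv_directSum_zmod_of_finite G
  let f : G ≃+ (Π i, ZMod (p i ^ e i)) :=
    g.trans (DirectSum.linearEquivFunOnFintype ℕ ι (fun i => ZMod (p i ^ e i))).toAddEquiv
  have hE1 : 1 ≤ AddMonoid.exponent G := Nat.pos_of_ne_zero AddMonoid.exponent_ne_zero_of_finite
  have hdvd : ∀ i, p i ^ e i ∣ AddMonoid.exponent G := fun i => by
    have hinj : Function.Injective (AddMonoidHom.single (fun j => ZMod (p j ^ e j)) i) :=
      Pi.single_injective (M := fun j => ZMod (p j ^ e j)) i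
    have h1 : addOrderOf (f.symm (AddMonoidHom.single (fun j => ZMod (p j ^ e j)) i 1)) = p i ^ e i := by
      rw [AddEquiv.addOrderOf_eq, addOrderOf_injective _ hinj, ZMod.addOrderOf_one]
    rw [← h1]
    exact AddMonoid.addOrder_dvd_exponent _
  have hcard : 30 ≤ ∏ i, p i ^ e i := by
    have : Nat.card G = ∏ i, p i ^ e i := by
      rw [Nat.card_congr f.toEquiv, Nat.card_pi]
      simp [Nat.card_zmod]
    rw [← this]; exact hG
  have h := exists_isSTPP_211pow6_pi p e hp hE1 (by omega) hdvd hcard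
  exact exists_isSTPP_211_of_injective f.symm.toAddMonoidHom f.symm.injective h

end Summit.MatrixMultiplication.OmegaCensus
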